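import Literature.Probability.LatticeModels.AnnulusManeuver
import HarnessLib

/-!
# The circuit maneuver N-ccw: a counter-clockwise circuit of the free walk below a northward slit

Topic `Literature/Probability/LatticeModels`; the lattice half of Chelkak's "crossings of annuli"
lemma (Chelkak 2016, Lemma 2.12), in the form used by the corrected boundary-decay lemma (his
Lemma 2.14) for the edge-killed walk: design N-ccw, the mirror image `x ↦ -x` of design N-cw
(`CircuitManeuverNcw.lean`). In units of `k` about the centre `c`: the free simple random walk
started in the box `[-28k, -20k] × [14k, 18k]` performs, with probability at least the universal
constant `circNccwConst > 0` (`circNccwConst_pos`, `circNccwConst_le_chainM`), the seven-step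
counter-clockwise circuit `circNccw` — down the left strip `[-36k, -12k] × [-40k, 19k]`
(truncated at height `19k`), turn, along the bottom strip `[-46k, 40k] × [-36k, -12k]` left to
right, turn, up the right strip `[12k, 36k] × [-46k, 19k]` (truncated at `19k`) — inside the box
`mW c k` of radius `48k` (`circNccwU_subset_mW`, `circNccwL_subset_mW`), never entering the
northward slit wedge `{z | z₁ - c₁ ≥ -9k - 1, 12 |z₀ - c₀| ≤ 5 (z₁ - c₁ + 9k) + 13}` nor the box
`|z₀ - c₀| ≤ 2k, -11k ≤ z₁ - c₁ ≤ -7k` (`circNccw_avoids`); and a positive KILLED chain at a start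
point of height `≥ 17k` in `S` yields, inside `S`, a bottom-to-top crossing of the left strip up
to height `17k`, a left-to-right crossing of the bottom strip, and a bottom-to-top crossing of the
right strip up to height `17k` (`circNccw_crossings_of_chainN_pos`).

The machinery — `MStep` and the one-step lower bound `MStep.lower_bound`, the free and killed
chains `chainM` / `chainN` of `ManeuverChain.lean` with `exists_walk_of_chainN_pos`, and
`exists_subwalk_slab` — is that of `AnnulusManeuver.lean`; only the step list differs. Landing
sets are middle halves of exit sides, start sets transverse middle thirds at depth `≥ k` from the
far side, and the design checks (`L i ⊆ T (i+1)`, everything inside `mW`, the forbidden zones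
avoided) are verified by `omega`. Everything is proved.

## References

* D. Chelkak, Robust discrete complex analysis: a toolbox, Ann. Probab. 44 (2016), Lemma 2.12
  (crossings of annuli) and Lemma 2.14 — bib key `Chelkak2016`.
* S. Smirnov, Ann. of Math. 172 (2010) 1435–1467, App. B, Lemma B.2 (the maneuver technique,
  after Kesten) — bib key `Smirnov2010`.
-/

noncomputable section

namespace Literature.Probability.LatticeModels

open Set SimpleGraph

/-! ### The seven steps -/

/-- **The counter-clockwise circuit for a northward slit** (units of `k`, centre `c`; entries
`⟨α, β, w, h, side⟩` = open rectangle `(αk, αk + wk) × (βk, βk + hk)` with exit side `0` right /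
`1` top / `2` left / `3` bottom): left strip `(-36k, -12k) × (-40k, 19k)` top to bottom, two
connectors into the bottom-left corner, bottom strip `(-46k, 40k) × (-36k, -12k)` left to right,
two connectors into the bottom-right corner, right strip `(12k, 36k) × (-46k, 19k)` bottom to top.
The mirror image `x ↦ -x` of design N-cw. [cite: Chelkak2016, Lemma 2.12] -/
def circNccw : Fin 7 → MStep :=
  ![⟨-36, -40, 24, 59, 3⟩, ⟨-41, -44, 35, 8, 2⟩, ⟨-45, -46, 8, 22, 1⟩, ⟨-46, -36, 86, 24, 0⟩,
    ⟨36, -41, 8, 35, 3⟩, ⟨24, -45, 22, 8, 2⟩, ⟨12, -46, 24, 65, 1⟩]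

section Nccw
variable (c : Site 2) (k : ℕ)

/-- Rectangles (empty beyond the seventh). [folklore] -/
def circNccwU (i : ℕ) : Set (Site 2) := if h : i < 7 then (circNccw ⟨i, h⟩).U c k else ∅
/-- Landing sets. [folklore] -/
def circNccwL (i : ℕ) : Set (Site 2) := if h : i < 7 then (circNccw ⟨i, h⟩).L c k else ∅
/-- Start sets (everything beyond the seventh). [folklore] -/
def circNccwT (i : ℕ) : Set (Site 2) := if h : i < 7 then (circNccw ⟨i, h⟩).T c k else Set.univ
/-- Step constants (`1` beyond the seventh). [folklore] -/
def circNccwStepConst (i : ℕ) : ℝ := if h : i < 7 then (circNccw ⟨i, h⟩).const else 1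
/-- The circuit constant `∏_{i<7} c_i`. [folklore] -/
def circNccwConst : ℝ := ∏ i ∈ Finset.range 7, circNccwStepConst i

/-! ### Constants -/

/-- The step constants are positive. [folklore] -/
theorem circNccwStepConst_pos (i : ℕ) : 0 < circNccwStepConst i := by
  unfold circNccwStepConst; split_ifs with h
  · apply MStep.const_pos <;> interval_cases i <;> simp [circNccw]
  · exact one_pos

/-- **The circuit constant is positive** (a universal constant). [folklore] -/
theorem circNccwConst_pos : 0 < circNccwConst := by
  exact Finset.prod_pos fun i _ => circNccwStepConst_pos i

/-- The tail products `∏_{i ≤ j < 7} c_j`. [folklore] -/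
def circNccwTail (i : ℕ) : ℝ := ∏ j ∈ Finset.Ico i 7, circNccwStepConst j

/-- Tail products are positive. [folklore] -/
theorem circNccwTail_pos (i : ℕ) : 0 < circNccwTail i := Finset.prod_pos fun j _ => circNccwStepConst_pos j

/-- `tail i = c_i · tail (i+1)` for `i < 7`. [folklore] -/
theorem circNccwTail_succ {i : ℕ} (hi : i < 7) : circNccwTail i = circNccwStepConst i * circNccwTail (i + 1) := by
  unfold circNccwTail
  rw [Finset.prod_eq_prod_Ico_succ_bot hi]

/-! ### Design checks -/

/-- The rectangles are finite. [folklore] -/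
theorem circNccwU_finite : ∀ i, (circNccwU c k i).Finite := by
  intro i
  unfold circNccwU; split_ifs
  · exact rectInterior_finite _ _ _
  · exact Set.finite_empty

variable {c k} in
/-- **Design check: each landing set lies in the next start set.** [folklore] -/
theorem circNccwL_subset_T (hk : 0 < k) {i : ℕ} (hi : i < 7) : circNccwL c k i ⊆ circNccwT c k (i + 1) := by
  intro x hx
  interval_cases i <;>
    simp only [circNccwL, circNccwT, circNccw, MStep.L, MStep.T, MStep.U, MStep.corner, rectInterior,
      Set.mem_setOf_eq, Matrix.cons_val_zero, Matrix.cons_val_one,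
      show (6 : ℕ) + 1 < 7 ↔ False by decide, dite_false, Set.mem_univ] at hx ⊢ <;>
    simp at hx ⊢ <;> omega

variable {c k} in
/-- Start sets lie in their rectangles. [folklore] -/
theorem circNccwT_subset_U {i : ℕ} (hi : i < 7) : circNccwT c k i ⊆ circNccwU c k i := by
  intro x hx
  simp only [circNccwT, circNccwU, dif_pos hi] at hx ⊢
  exact hx.1

/-- **Design check: the rectangles lie in the region `mW` (the box of radius `48k`).** [folklore] -/
theorem circNccwU_subset_mW : ∀ i, circNccwU c k i ⊆ mW c k := by
  intro i x hx
  by_cases hi : i < 7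
  · simp only [mW, Set.mem_setOf_eq, abs_le]
    interval_cases i <;>
      simp only [circNccwU, circNccw, MStep.U, MStep.corner, rectInterior,
        Matrix.cons_val_zero, Matrix.cons_val_one] at hx <;>
      simp at hx <;> omega
  · simp [circNccwU, hi] at hx

/-- **Design check: the landing sets lie in the region.** [folklore] -/
theorem circNccwL_subset_mW : 0 < k → ∀ i, circNccwL c k i ⊆ mW c k := by
  intro hk i x hx
  by_cases hi : i < 7
  · simp only [mW, Set.mem_setOf_eq, abs_le]
    interval_cases i <;>
      simp only [circNccwL, circNccw, MStep.L] at hx <;>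
      simp at hx <;> omega
  · simp [circNccwL, hi] at hx

/-- **Design check: landing sets are disjoint from their (open) rectangles.** [folklore] -/
theorem disjoint_circNccwU_L : ∀ i, Disjoint (circNccwU c k i) (circNccwL c k i) := by
  intro i
  rw [Set.disjoint_left]
  intro x hxU hxL
  by_cases hi : i < 7
  · interval_cases i <;>
      simp only [circNccwU, circNccwL, circNccw, MStep.L, MStep.U, MStep.corner, rectInterior,
        Matrix.cons_val_zero, Matrix.cons_val_one] at hxU hxL <;>
      simp at hxU hxL <;> omega
  · simp [circNccwU, hi] at hxU

/-- **Design check: the start box `[-28k, -20k] × [14k, 18k]` lies in the first start set.**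
[folklore] -/
theorem circNccw_start : 0 < k → ∀ x : Site 2, -28 * (k : ℤ) ≤ x 0 - c 0 → x 0 - c 0 ≤ -20 * k → 14 * k ≤ x 1 - c 1 →
    x 1 - c 1 ≤ 18 * k → x ∈ circNccwT c k 0 := by
  intro hk x h0 h0' h1 h1'
  simp only [circNccwT, circNccw, MStep.T, MStep.U, MStep.corner, rectInterior, Set.mem_setOf_eq,
    Matrix.cons_val_zero, Matrix.cons_val_one, show (0 : ℕ) < 7 by decide, dite_true]
  simp
  omega

/-- **Design check: the circuit avoids the germ box and the northward slit wedge.** Every site of a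
rectangle or landing set of the design lies outside the box `|z₀ - c₀| ≤ 2k, -11k ≤ z₁ - c₁ ≤ -7k`
and outside the wedge `{z | z₁ - c₁ ≥ -9k - 1, 12 |z₀ - c₀| ≤ 5 (z₁ - c₁ + 9k) + 13}` (the sites
within `1` of the cone of half-aperture `arctan (12/5) ≈ 67.38°` about the northward ray from
`c - (0, 9k)`, i.e. of the slits with direction within `22.62°` of north). [folklore] -/
theorem circNccw_avoids : 5 ≤ k → ∀ i, ∀ z ∈ circNccwU c k i ∪ circNccwL c k i,
    (2 * (k : ℤ) < |z 0 - c 0| ∨ z 1 - c 1 < -11 * k ∨ -7 * (k : ℤ) < z 1 - c 1) ∧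
    (z 1 - c 1 < -9 * k - 1 ∨ 5 * (z 1 - c 1 + 9 * k) + 13 < 12 * |z 0 - c 0|) := by
  intro hk i z hz
  by_cases hi : i < 7
  · rcases abs_cases (z 0 - c 0) with ⟨h, h'⟩ | ⟨h, h'⟩ <;> rw [h] <;>
    interval_cases i <;>
      simp only [circNccwU, circNccwL, circNccw, MStep.U, MStep.L, MStep.corner, rectInterior, Set.mem_union,
        Matrix.cons_val_zero, Matrix.cons_val_one] at hz <;>
      simp at hz <;> omega
  · simp [circNccwU, circNccwL, hi] at hz

/-! ### The free chain is bounded below on the start set -/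

variable {c k} in
/-- **The free chain is at least the tail product on the start sets**: downward induction with the
one-step lower bound `MStep.lower_bound` (every step has `w, h ≥ 8`) and `L i ⊆ T (i+1)`.
[folklore] -/
theorem circNccwTail_le_chainM (hk : 0 < k) {j : ℕ} (hj : j ≤ 7) {x : Site 2} (hx : x ∈ circNccwT c k (7 - j)) :
    circNccwTail (7 - j) ≤ chainM (circNccwU c k) (circNccwL c k) 7 j x := by
  classical
  induction j generalizing x with
  | zero => simp [circNccwTail, chainM]
  | succ j ih =>
    have hi : 7 - (j + 1) < 7 := by omega
    set i := 7 - (j + 1) with hidef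
    have hi' : 7 - 1 - j = i := by omega
    have hsucc : 7 - j = i + 1 := by omega
    simp only [chainM, hi']
    rw [circNccwTail_succ hi]
    -- the data `g = 1_{L i} · M_j`
    have hM0 : ∀ w, 0 ≤ chainM (circNccwU c k) (circNccwL c k) 7 j w :=
      fun w => (chainM_mem_Icc (circNccwU_finite c k) j w).1
    have hT : ∀ w ∈ circNccwL c k i, circNccwTail (i + 1) ≤ chainM (circNccwU c k) (circNccwL c k) 7 j w := by
      intro w hw
      have := ih (by omega) (x := w) (by rw [hsucc]; exact circNccwL_subset_T hk hi hw)
      rwa [hsucc] at this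
    have key := MStep.lower_bound (circNccw ⟨i, hi⟩) c k hk (by interval_cases i <;> simp [circNccw])
      (by interval_cases i <;> simp [circNccw])
      (g := fun w => if w ∈ circNccwL c k i then chainM (circNccwU c k) (circNccwL c k) 7 j w else 0)
      (fun w => by split_ifs <;> [exact hM0 w; exact le_rfl]) (circNccwTail_pos (i + 1)).le
      (fun w hw => by
        have hw' : w ∈ circNccwL c k i := by simp only [circNccwL, dif_pos hi]; exact hw
        simp only [hw', if_true]; exact hT w hw') (x := x) (by simp only [circNccwT, dif_pos hi] at hx; exact hx)
    rw [mul_comm]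
    have hU : (circNccw ⟨i, hi⟩).U c k = circNccwU c k i := by simp only [circNccwU, dif_pos hi]
    have hc : (circNccw ⟨i, hi⟩).const = circNccwStepConst i := by simp only [circNccwStepConst, dif_pos hi]
    rw [hU, hc] at key
    exact key

/-- **`M ≥ c_*` on the first start set**: the free walk started in `circNccwT c k 0` (in
particular in the box `[-28k, -20k] × [14k, 18k]`, `circNccw_start`) performs the whole circuit
with probability at least `circNccwConst`. [cite: Chelkak2016, Lemma 2.12] -/
theorem circNccwConst_le_chainM : 0 < k → ∀ x ∈ circNccwT c k 0,
    circNccwConst ≤ chainM (circNccwU c k) (circNccwL c k) 7 7 x := by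
  intro hk x hx
  have h := circNccwTail_le_chainM hk le_rfl (x := x) hx
  have e : circNccwTail (7 - 7) = circNccwConst := by
    simp only [Nat.sub_self, circNccwTail, circNccwConst, Finset.range_eq_Ico]
  rw [e] at h; exact h

/-! ### A positive killed chain forces three strip crossings inside `S` -/

variable {S : Set (Site 2)}

variable {c k} in
/-- One step of the killed circuit inside `S` (wrapper of `exists_walk_of_chainN_pos`). [folklore] -/
theorem circNccw_iter_step {i : ℕ} (hi : i < 7) {y : Site 2} (hy : y ∈ circNccwU c k i) (hyS : y ∈ S)
    (hpos : 0 < chainN (circNccwU c k) (circNccwL c k) S 7 (7 - i) y) :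
    ∃ y', y' ∈ circNccwL c k i ∧ y' ∈ S ∧ 0 < chainN (circNccwU c k) (circNccwL c k) S 7 (6 - i) y' ∧
      ∃ p : (zdGraph 2).Walk y y', ∀ z ∈ p.support, z ∈ S ∧ (z ∈ circNccwU c k i ∨ z = y') := by
  have e1 : 7 - 1 - (6 - i) = i := by omega
  have e2 : 7 - i = (6 - i) + 1 := by omega
  rw [e2] at hpos
  have := exists_walk_of_chainN_pos (U := circNccwU c k) (L := circNccwL c k) (S := S) (n := 7)
    (circNccwU_finite c k) (6 - i) (x := y) (by rw [e1]; exact ⟨hy, hyS⟩) hpos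
  rw [e1] at this
  exact this

/-- **Three strip crossings in `S`** (the lattice half of the crossings-of-annuli lemma). If the
killed chain of the circuit is positive at a point `x ∈ S` of the first start set with
`x₁ ≥ c₁ + 17k`, then `S` contains a bottom-to-top crossing of the truncated left strip
`[-36k, -12k] × [-36k, 17k]`, a left-to-right crossing of the bottom strip
`[-36k, 36k] × [-36k, -12k]`, and a bottom-to-top crossing of the truncated right strip
`[12k, 36k] × [-36k, 17k]` (all relative to `c`). [cite: Chelkak2016, Lemma 2.12] -/
theorem circNccw_crossings_of_chainN_pos {S : Set (Site 2)} : 0 < k → ∀ x ∈ circNccwT c k 0, x ∈ S →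
    c 1 + 17 * k ≤ x 1 → 0 < chainN (circNccwU c k) (circNccwL c k) S 7 7 x →
    (∃ (u v : Site 2) (σ : (zdGraph 2).Walk u v), u 1 = c 1 - 36 * k ∧ v 1 = c 1 + 17 * k ∧
      ∀ z ∈ σ.support, z ∈ S ∧ c 0 - 36 * k ≤ z 0 ∧ z 0 ≤ c 0 - 12 * k ∧ c 1 - 36 * k ≤ z 1 ∧ z 1 ≤ c 1 + 17 * k) ∧
    (∃ (u v : Site 2) (σ : (zdGraph 2).Walk u v), u 0 = c 0 - 36 * k ∧ v 0 = c 0 + 36 * k ∧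
      ∀ z ∈ σ.support, z ∈ S ∧ c 0 - 36 * k ≤ z 0 ∧ z 0 ≤ c 0 + 36 * k ∧ c 1 - 36 * k ≤ z 1 ∧ z 1 ≤ c 1 - 12 * k) ∧
    (∃ (u v : Site 2) (σ : (zdGraph 2).Walk u v), u 1 = c 1 - 36 * k ∧ v 1 = c 1 + 17 * k ∧
      ∀ z ∈ σ.support, z ∈ S ∧ c 0 + 12 * k ≤ z 0 ∧ z 0 ≤ c 0 + 36 * k ∧ c 1 - 36 * k ≤ z 1 ∧ z 1 ≤ c 1 + 17 * k) := by
  intro hk x hx hxS hx1 hpos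
  have hTU : ∀ {i : ℕ} (_ : i + 1 < 7) {y : Site 2}, y ∈ circNccwL c k i → y ∈ circNccwU c k (i + 1) :=
    fun {i} hi {y} hy => circNccwT_subset_U hi (circNccwL_subset_T hk (by omega) hy)
  -- the seven steps
  have hx0 : x ∈ circNccwU c k 0 := circNccwT_subset_U (by decide) hx
  obtain ⟨y1, hL1, hS1, hp1, p0, hw0⟩ := circNccw_iter_step (by decide : 0 < 7) hx0 hxS hpos
  obtain ⟨y2, hL2, hS2, hp2, -⟩ := circNccw_iter_step (by decide : 1 < 7) (hTU (by decide) hL1) hS1 hp1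
  obtain ⟨y3, hL3, hS3, hp3, -⟩ := circNccw_iter_step (by decide : 2 < 7) (hTU (by decide) hL2) hS2 hp2
  obtain ⟨y4, hL4, hS4, hp4, p3, hw3⟩ := circNccw_iter_step (by decide : 3 < 7) (hTU (by decide) hL3) hS3 hp3
  obtain ⟨y5, hL5, hS5, hp5, -⟩ := circNccw_iter_step (by decide : 4 < 7) (hTU (by decide) hL4) hS4 hp4
  obtain ⟨y6, hL6, hS6, hp6, -⟩ := circNccw_iter_step (by decide : 5 < 7) (hTU (by decide) hL5) hS5 hp5
  obtain ⟨y7, hL7, hS7, -, p6, hw6⟩ := circNccw_iter_step (by decide : 6 < 7) (hTU (by decide) hL6) hS6 hp6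
  -- coordinates of the landing points and of the supports
  simp only [circNccwL, circNccwU, circNccw, MStep.L, MStep.U, MStep.corner, rectInterior, Set.mem_setOf_eq,
    Matrix.cons_val_zero, Matrix.cons_val_one, show (0:ℕ) < 7 by decide, show (2:ℕ) < 7 by decide,
    show (3:ℕ) < 7 by decide, show (5:ℕ) < 7 by decide, show (6:ℕ) < 7 by decide,
    dif_pos] at hL1 hL3 hL4 hL6 hL7 hw0 hw3 hw6
  simp at hL1 hL3 hL4 hL6 hL7 hw0 hw3 hw6
  refine ⟨?_, ?_, ?_⟩
  · -- left strip from `p0 : x → y1`, reversed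
    obtain ⟨u, v, σ, hu, hv, hsub, hσ⟩ := exists_subwalk_slab p0.reverse 1 (L := c 1 - 36 * k) (R := c 1 + 17 * k)
      (by omega) (by omega) (by omega)
    refine ⟨u, v, σ, hu, hv, fun z hz => ?_⟩
    have hz' : z ∈ p0.support := by have := hsub z hz; rwa [Walk.support_reverse, List.mem_reverse] at this
    have h1 := hw0 z hz'; have h2 := hσ z hz
    refine ⟨h1.1, ?_, ?_, h2.1, h2.2⟩ <;> rcases h1.2 with h | rfl <;> omega
  · -- bottom strip from `p3 : y3 → y4`
    obtain ⟨u, v, σ, hu, hv, hsub, hσ⟩ := exists_subwalk_slab p3 0 (L := c 0 - 36 * k) (R := c 0 + 36 * k)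
      (by omega) (by omega) (by omega)
    refine ⟨u, v, σ, hu, hv, fun z hz => ?_⟩
    have h1 := hw3 z (hsub z hz); have h2 := hσ z hz
    refine ⟨h1.1, h2.1, h2.2, ?_, ?_⟩ <;> rcases h1.2 with h | rfl <;> omega
  · -- right strip from `p6 : y6 → y7`
    obtain ⟨u, v, σ, hu, hv, hsub, hσ⟩ := exists_subwalk_slab p6 1 (L := c 1 - 36 * k) (R := c 1 + 17 * k)
      (by omega) (by omega) (by omega)
    refine ⟨u, v, σ, hu, hv, fun z hz => ?_⟩
    have h1 := hw6 z (hsub z hz); have h2 := hσ z hz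
    refine ⟨h1.1, ?_, ?_, h2.1, h2.2⟩ <;> rcases h1.2 with h | rfl <;> omega

end Nccw

end Literature.Probability.LatticeModels
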